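import Mathlib
import Summits.Ventures.PercRepro2.Defs
import Summits.Ventures.PercRepro2.Independence
import Summits.Ventures.PercRepro2.CoinDefs
import Summits.Ventures.PercRepro2.CoinReverse
import Summits.Ventures.PercRepro2.CoinInduced
import Summits.Ventures.PercRepro2.CoinPendantDefs
import Summits.Ventures.PercRepro2.CoinTraceLevels
import Summits.Ventures.PercRepro2.CoinLsmCoreDefs
import Summits.Ventures.PercRepro2.CoinLsmCoreU

/-!
# OR-tail cores over two independent branches: structure, reachability, the level
factorisation (blind cell PercRepro2, night-2 g9; proofs/NIGHT2-DARC.md §35)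

An OR-TAIL CORE: two disjoint closed-in BRANCHES `B₁ ∋ p`, `B₂ ∋ q` of the root `s` (every arc into
`B_i` comes from `B_i ∪ {s}`; arcs into `s` only from the branches — antiparallel pairs at the root
are allowed), and a TAIL `a` entered ONLY by the two single-arc coins `cρ = {p → a}`, `cτ = {q → a}`.
The whole `C = B₁ ∪ B₂ ∪ {a}` is a closed-in core (`closedInCoreU`), `s ⇝ a` iff `s ⇝ p` and `cρ`
is open or `s ⇝ q` and `cτ` is open (`reach_a_iff`), and the core level of `W ⊆ C` FACTORISES:
`P(level_C W) = P(level_{B₁} (W ∩ B₁)) · P(level_{B₂} (W ∩ B₂)) · tail(W)` with the tail factor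
`tail(W) = 1 − g` if `a ∈ W` and `g` otherwise, `g = (1 − ρ·1[p ∈ W])·(1 − τ·1[q ∈ W])`
(`prob_coreLevel_eq`): the branch levels depend on the branch coins only, the tail event on
`cρ, cτ` only, and the three coin sets are disjoint.
-/

namespace Summit.Ventures.PercRepro2.Coin

open Classical

section OrTailStructure

variable {V : Type*} {E : Type*} [DecidableEq V]

/-- An OR-tail core: two disjoint closed-in branches `B₁ ∋ p`, `B₂ ∋ q` below `s`, and the tail `a`
entered only by the single-arc coins `cρ = {p → a}` and `cτ = {q → a}`. -/
structure OrTailCore (arcs : E → Finset (V × V)) (s : V) (B₁ B₂ : Finset V) (p q a : V)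
    (cρ cτ : E) : Prop where
  p_mem : p ∈ B₁
  q_mem : q ∈ B₂
  disj : Disjoint B₁ B₂
  s_notin₁ : s ∉ B₁
  s_notin₂ : s ∉ B₂
  a_notin₁ : a ∉ B₁
  a_notin₂ : a ∉ B₂
  a_ne_s : a ≠ s
  into₁ : ∀ e, ∀ xy ∈ arcs e, xy.2 ∈ B₁ → xy.1 ∈ B₁ ∨ xy.1 = s
  into₂ : ∀ e, ∀ xy ∈ arcs e, xy.2 ∈ B₂ → xy.1 ∈ B₂ ∨ xy.1 = s
  into_s : ∀ e, ∀ xy ∈ arcs e, xy.2 = s → xy.1 ∈ B₁ ∨ xy.1 ∈ B₂ ∨ xy.1 = s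
  into_a : ∀ e, ∀ xy ∈ arcs e, xy.2 = a → (e = cρ ∧ xy.1 = p) ∨ (e = cτ ∧ xy.1 = q)
  arcs_ρ : arcs cρ = {(p, a)}
  arcs_τ : arcs cτ = {(q, a)}
  ρτ_ne : cρ ≠ cτ

variable {arcs : E → Finset (V × V)} {s : V} {B₁ B₂ : Finset V} {p q a : V} {cρ cτ : E}

omit [DecidableEq V] in
/-- `p ≠ a`. -/
lemma OrTailCore.p_ne_a (h : OrTailCore arcs s B₁ B₂ p q a cρ cτ) : p ≠ a :=
  fun e => h.a_notin₁ (e ▸ h.p_mem)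

omit [DecidableEq V] in
/-- `q ≠ a`. -/
lemma OrTailCore.q_ne_a (h : OrTailCore arcs s B₁ B₂ p q a cρ cτ) : q ≠ a :=
  fun e => h.a_notin₂ (e ▸ h.q_mem)

omit [DecidableEq V] in
/-- `p ∉ B₂`. -/
lemma OrTailCore.p_notin₂ (h : OrTailCore arcs s B₁ B₂ p q a cρ cτ) : p ∉ B₂ :=
  Finset.disjoint_left.1 h.disj h.p_mem

omit [DecidableEq V] in
/-- `q ∉ B₁`. -/
lemma OrTailCore.q_notin₁ (h : OrTailCore arcs s B₁ B₂ p q a cρ cτ) : q ∉ B₁ :=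
  Finset.disjoint_right.1 h.disj h.q_mem

/-- `a ∉ B₁ ∪ B₂`. -/
lemma OrTailCore.a_notin (h : OrTailCore arcs s B₁ B₂ p q a cρ cτ) : a ∉ B₁ ∪ B₂ := by
  rw [Finset.mem_union]; rintro (h1 | h2)
  · exact h.a_notin₁ h1
  · exact h.a_notin₂ h2

/-- The whole core `B₁ ∪ B₂ ∪ {a}` is a closed-in core (pairs at the root allowed). -/
lemma OrTailCore.closedInCoreU (h : OrTailCore arcs s B₁ B₂ p q a cρ cτ) :
    ClosedInCoreU arcs s (insert a (B₁ ∪ B₂)) where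
  into_C := by
    intro e xy hxy hy
    simp only [Finset.mem_insert, Finset.mem_union] at hy ⊢
    rcases hy with hy | hy | hy
    · rcases h.into_a e xy hxy hy with ⟨_, hx⟩ | ⟨_, hx⟩
      · exact Or.inl (Or.inr (Or.inl (hx ▸ h.p_mem)))
      · exact Or.inl (Or.inr (Or.inr (hx ▸ h.q_mem)))
    · rcases h.into₁ e xy hxy hy with hx | hx
      · exact Or.inl (Or.inr (Or.inl hx))
      · exact Or.inr hx
    · rcases h.into₂ e xy hxy hy with hx | hx
      · exact Or.inl (Or.inr (Or.inr hx))
      · exact Or.inr hx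
  into_s := by
    intro e xy hxy hy
    simp only [Finset.mem_insert, Finset.mem_union]
    rcases h.into_s e xy hxy hy with hx | hx | hx
    · exact Or.inl (Or.inr (Or.inl hx))
    · exact Or.inl (Or.inr (Or.inr hx))
    · exact Or.inr hx
  s_notin := by
    simp only [Finset.mem_insert, Finset.mem_union, not_or]
    exact ⟨h.a_ne_s.symm, h.s_notin₁, h.s_notin₂⟩

omit [DecidableEq V] in
/-- An open arc into `a` is the tail coin `cρ` from `p` or the tail coin `cτ` from `q`. -/
lemma OrTailCore.openArc_a_iff (h : OrTailCore arcs s B₁ B₂ p q a cρ cτ) {ω : Config E} {x : V} :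
    OpenArc arcs ω x a ↔ (x = p ∧ ω cρ = true) ∨ (x = q ∧ ω cτ = true) := by
  constructor
  · rintro ⟨e, he, hxa⟩
    rcases h.into_a e (x, a) hxa rfl with ⟨rfl, hx⟩ | ⟨rfl, hx⟩
    · exact Or.inl ⟨hx, he⟩
    · exact Or.inr ⟨hx, he⟩
  · rintro (⟨rfl, he⟩ | ⟨rfl, he⟩)
    · exact ⟨cρ, he, by rw [h.arcs_ρ]; exact Finset.mem_singleton_self _⟩
    · exact ⟨cτ, he, by rw [h.arcs_τ]; exact Finset.mem_singleton_self _⟩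

omit [DecidableEq V] in
/-- **The tail is reached iff one of its two routes is complete and its coin open.** -/
lemma OrTailCore.reach_a_iff (h : OrTailCore arcs s B₁ B₂ p q a cρ cτ) {ω : Config E} :
    Reach arcs ω s a ↔
      (Reach arcs ω s p ∧ ω cρ = true) ∨ (Reach arcs ω s q ∧ ω cτ = true) := by
  constructor
  · intro hr
    rcases Relation.ReflTransGen.cases_tail hr with hsa | ⟨x, hsx, hxa⟩
    · exact absurd hsa h.a_ne_s
    · rcases h.openArc_a_iff.1 hxa with ⟨rfl, he⟩ | ⟨rfl, he⟩
      · exact Or.inl ⟨hsx, he⟩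
      · exact Or.inr ⟨hsx, he⟩
  · rintro (⟨hsp, he⟩ | ⟨hsq, he⟩)
    · exact reach_trans hsp (reach_of_openArc (h.openArc_a_iff.2 (Or.inl ⟨rfl, he⟩)))
    · exact reach_trans hsq (reach_of_openArc (h.openArc_a_iff.2 (Or.inr ⟨rfl, he⟩)))

/-- The tail event of the level `W`: `a ∈ W` iff «`p ∈ W` and `cρ` open, or `q ∈ W` and `cτ`
open» — a statement about the two tail coins only. -/
def tailEvent (p q a : V) (cρ cτ : E) (W : Finset V) : Set (Config E) :=
  {ω | a ∈ W ↔ (p ∈ W ∧ ω cρ = true) ∨ (q ∈ W ∧ ω cτ = true)}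

omit [DecidableEq V] in
/-- Membership in the tail event. -/
lemma mem_tailEvent {W : Finset V} {ω : Config E} :
    ω ∈ tailEvent p q a cρ cτ W ↔
      (a ∈ W ↔ (p ∈ W ∧ ω cρ = true) ∨ (q ∈ W ∧ ω cτ = true)) := Iff.rfl

omit [DecidableEq V] in
/-- The tail event depends on the two tail coins only. -/
lemma dependsOn_tailEvent (p q a : V) (cρ cτ : E) (W : Finset V) :
    DependsOn (· ∈ tailEvent p q a cρ cτ W) ({cρ, cτ} : Set E) := by
  intro ω ω' hh
  simp only [tailEvent, Set.mem_setOf_eq, eq_iff_iff]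
  rw [hh cρ (by simp), hh cτ (by simp)]

/-- **The level factorisation (as events)**: the core level of `W ⊆ B₁ ∪ B₂ ∪ {a}` is the
intersection of the two branch levels and the tail event. -/
theorem OrTailCore.coreLevel_eq (h : OrTailCore arcs s B₁ B₂ p q a cρ cτ) (W : Finset V) :
    coreLevel arcs s (insert a (B₁ ∪ B₂)) W =
      coreLevel arcs s B₁ (W ∩ B₁) ∩ coreLevel arcs s B₂ (W ∩ B₂) ∩ tailEvent p q a cρ cτ W := by
  ext ω
  simp only [Set.mem_inter_iff, mem_coreLevel, mem_tailEvent, Finset.mem_inter,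
    Finset.mem_insert, Finset.mem_union]
  constructor
  · intro hW
    refine ⟨⟨fun z hz => ?_, fun z hz => ?_⟩, ?_⟩
    · rw [and_iff_left hz]; exact hW z (Or.inr (Or.inl hz))
    · rw [and_iff_left hz]; exact hW z (Or.inr (Or.inr hz))
    · rw [hW a (Or.inl rfl), h.reach_a_iff, hW p (Or.inr (Or.inl h.p_mem)),
        hW q (Or.inr (Or.inr h.q_mem))]
  · rintro ⟨⟨h1, h2⟩, h3⟩ z hz
    rcases hz with rfl | hz | hz
    · rw [h3, h.reach_a_iff, ← and_iff_left (a := p ∈ W) h.p_mem, h1 p h.p_mem,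
        ← and_iff_left (a := q ∈ W) h.q_mem, h2 q h.q_mem]
    · rw [← and_iff_left (a := z ∈ W) hz]; exact h1 z hz
    · rw [← and_iff_left (a := z ∈ W) hz]; exact h2 z hz

/-- A branch is closed out into `s` in the reversed system (only its `into` condition is used). -/
lemma closedOut_rev_of_into {B : Finset V}
    (hinto : ∀ e, ∀ xy ∈ arcs e, xy.2 ∈ B → xy.1 ∈ B ∨ xy.1 = s) :
    ClosedOut (revArcs arcs) B {s} := by
  intro e xy hxy hx
  rw [mem_revArcs] at hxy
  rw [Finset.mem_union, Finset.mem_singleton]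
  exact hinto e _ hxy hx

/-- The level of a branch depends on the branch's coins only. -/
lemma dependsOn_coreLevel_of_into {B : Finset V}
    (hinto : ∀ e, ∀ xy ∈ arcs e, xy.2 ∈ B → xy.1 ∈ B ∨ xy.1 = s) (W : Finset V) :
    DependsOn (· ∈ coreLevel arcs s B W) (coreCoins arcs B) :=
  dependsOn_traceLevel (closedOut_rev_of_into hinto) W

/-- The coins of the two branches are disjoint (`SameEnds` + closed-in). -/
lemma OrTailCore.disjoint_coreCoins (h : OrTailCore arcs s B₁ B₂ p q a cρ cτ)
    (hS : SameEnds arcs) : Disjoint (coreCoins arcs B₁) (coreCoins arcs B₂) := by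
  rw [Set.disjoint_left]
  intro e h1 h2
  obtain ⟨⟨x, y⟩, hxy, hy⟩ := mem_coreCoins.mp h1
  obtain ⟨⟨x', y'⟩, hxy', hy'⟩ := mem_coreCoins.mp h2
  have hends := hS e (x, y) hxy (x', y') hxy'
  simp only at hends hy hy'
  -- `y ∈ B₁`, `y' ∈ B₂`, the endpoint sets agree: `y' = x`, so the arc `x → y` into `B₁` has
  -- its tail in `B₂`
  have hyy' : y' ≠ y := fun e => Finset.disjoint_left.1 h.disj (e ▸ hy) hy'
  have hy'x : y' = x := by
    rcases hends.2 with hh | hh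
    · exact hh
    · exact absurd hh hyy'
  have hx₂ : x ∈ B₂ := hy'x ▸ hy'
  rcases h.into₁ e (x, y) hxy hy with hx | hx
  · exact Finset.disjoint_left.1 h.disj hx hx₂
  · exact h.s_notin₂ (hx ▸ hx₂)

/-- The tail coin `cρ` carries no arc into a branch. -/
lemma OrTailCore.cρ_notin_coreCoins (h : OrTailCore arcs s B₁ B₂ p q a cρ cτ) {B : Finset V}
    (haB : a ∉ B) : cρ ∉ coreCoins arcs B := by
  intro hmem
  obtain ⟨xy, hxy, hy⟩ := mem_coreCoins.mp hmem
  rw [h.arcs_ρ, Finset.mem_singleton] at hxy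
  subst hxy
  exact haB hy

/-- The tail coin `cτ` carries no arc into a branch. -/
lemma OrTailCore.cτ_notin_coreCoins (h : OrTailCore arcs s B₁ B₂ p q a cρ cτ) {B : Finset V}
    (haB : a ∉ B) : cτ ∉ coreCoins arcs B := by
  intro hmem
  obtain ⟨xy, hxy, hy⟩ := mem_coreCoins.mp hmem
  rw [h.arcs_τ, Finset.mem_singleton] at hxy
  subst hxy
  exact haB hy

/-- The tail coins are disjoint from the branch coins. -/
lemma OrTailCore.disjoint_tailCoins (h : OrTailCore arcs s B₁ B₂ p q a cρ cτ) :
    Disjoint (coreCoins arcs B₁ ∪ coreCoins arcs B₂) ({cρ, cτ} : Set E) := by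
  rw [Set.disjoint_right]
  intro e he
  simp only [Set.mem_insert_iff, Set.mem_singleton_iff] at he
  rw [Set.mem_union, not_or]
  rcases he with rfl | rfl
  · exact ⟨h.cρ_notin_coreCoins h.a_notin₁, h.cρ_notin_coreCoins h.a_notin₂⟩
  · exact ⟨h.cτ_notin_coreCoins h.a_notin₁, h.cτ_notin_coreCoins h.a_notin₂⟩

end OrTailStructure

section OrTailProb

variable {V : Type*} {E : Type*} [DecidableEq V] [Fintype E] [DecidableEq E]
  {R : Type*} [CommRing R]
  {arcs : E → Finset (V × V)} {s : V} {B₁ B₂ : Finset V} {p q a : V} {cρ cτ : E}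

/-- **The level factorisation (probabilities)**: the branch levels and the tail event are
independent. -/
theorem OrTailCore.prob_coreLevel_eq (h : OrTailCore arcs s B₁ B₂ p q a cρ cτ)
    (hS : SameEnds arcs) (pr : E → R) (W : Finset V) :
    prob pr (coreLevel arcs s (insert a (B₁ ∪ B₂)) W) =
      prob pr (coreLevel arcs s B₁ (W ∩ B₁)) * prob pr (coreLevel arcs s B₂ (W ∩ B₂)) *
        prob pr (tailEvent p q a cρ cτ W) := by
  rw [h.coreLevel_eq W,
    prob_inter_eq_mul_of_dependsOn pr h.disjoint_tailCoins
      (dependsOn_inter (dependsOn_coreLevel_of_into h.into₁ _)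
        (dependsOn_coreLevel_of_into h.into₂ _)) (dependsOn_tailEvent p q a cρ cτ W),
    prob_inter_eq_mul_of_dependsOn pr (h.disjoint_coreCoins hS)
      (dependsOn_coreLevel_of_into h.into₁ _) (dependsOn_coreLevel_of_into h.into₂ _)]

/-- The two tail coins are independent: `P(both open) = ρ τ`. -/
lemma prob_openEdge_inter_openEdge (pr : E → R) {e e' : E} (hne : e ≠ e') :
    prob pr (openEdge e ∩ openEdge e') = pr e * pr e' := by
  rw [prob_inter_eq_mul_of_dependsOn pr (Set.disjoint_singleton.2 hne) (dependsOn_openEdge e)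
    (dependsOn_openEdge e'), prob_openEdge, prob_openEdge]

/-- The two tail coins are independent: `P(both closed) = (1 − ρ)(1 − τ)`. -/
lemma prob_closedEdge_inter_closedEdge (pr : E → R) {e e' : E} (hne : e ≠ e') :
    prob pr (closedEdge e ∩ closedEdge e') = (1 - pr e) * (1 - pr e') := by
  rw [prob_inter_eq_mul_of_dependsOn pr (Set.disjoint_singleton.2 hne) (dependsOn_closedEdge e)
    (dependsOn_closedEdge e'), prob_closedEdge, prob_closedEdge]

/-- **The tail factor**: `P(tail event of W) = 1 − g` if `a ∈ W`, `g` otherwise, where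
`g = (1 − ρ·1[p ∈ W])·(1 − τ·1[q ∈ W])` is the probability that `a` is not entered. -/
theorem prob_tailEvent (pr : E → R) (hne : cρ ≠ cτ) (W : Finset V) :
    prob pr (tailEvent p q a cρ cτ W) =
      if a ∈ W then
        1 - (1 - pr cρ * (if p ∈ W then (1 : R) else 0)) * (1 - pr cτ * (if q ∈ W then (1 : R) else 0))
      else
        (1 - pr cρ * (if p ∈ W then (1 : R) else 0)) * (1 - pr cτ * (if q ∈ W then (1 : R) else 0)) := by
  by_cases ha : a ∈ W <;> by_cases hp : p ∈ W <;> by_cases hq : q ∈ W <;>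
    simp only [ha, hp, hq, if_true, if_false, mul_one, mul_zero, sub_zero]
  · have hT : tailEvent p q a cρ cτ W = openEdge cρ ∪ openEdge cτ := by
      ext ω; simp [tailEvent, ha, hp, hq]
    have hu := prob_union_add_prob_inter pr (openEdge cρ) (openEdge cτ)
    rw [hT, prob_openEdge_inter_openEdge pr hne, prob_openEdge, prob_openEdge] at *
    linear_combination hu
  · have hT : tailEvent p q a cρ cτ W = openEdge cρ := by
      ext ω; simp [tailEvent, ha, hp, hq]
    rw [hT, prob_openEdge]; ring
  · have hT : tailEvent p q a cρ cτ W = openEdge cτ := by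
      ext ω; simp [tailEvent, ha, hp, hq]
    rw [hT, prob_openEdge]; ring
  · have hT : tailEvent p q a cρ cτ W = ∅ := by
      ext ω; simp [tailEvent, ha, hp, hq]
    rw [hT, prob_empty]; ring
  · have hT : tailEvent p q a cρ cτ W = closedEdge cρ ∩ closedEdge cτ := by
      ext ω; simp [tailEvent, ha, hp, hq]
    rw [hT, prob_closedEdge_inter_closedEdge pr hne]
  · have hT : tailEvent p q a cρ cτ W = closedEdge cρ := by
      ext ω; simp [tailEvent, ha, hp, hq]
    rw [hT, prob_closedEdge]
  · have hT : tailEvent p q a cρ cτ W = closedEdge cτ := by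
      ext ω; simp [tailEvent, ha, hp, hq]
    rw [hT, prob_closedEdge]; ring
  · have hT : tailEvent p q a cρ cτ W = Set.univ := by
      ext ω; simp [tailEvent, ha, hp, hq]
    rw [hT, prob_univ]

end OrTailProb

end Summit.Ventures.PercRepro2.Coin
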